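import Literature.Analysis.FluidPDE.PassiveVectorGalerkin
import Literature.Analysis.FluidPDE.PassiveVectorTensorModalAdjointCoeff
import Literature.Analysis.FunctionSpaces.TorusConvectionLaplacianNormSq
import Literature.Analysis.FunctionSpaces.TorusFourierCalculus
import HarnessLib

/-!
# Tools for the ENSTROPHY balance of Fourier–Galerkin approximations of passive vectors with a smooth drift

Analysis/FluidPDE proof-support file (everything proved; no definitions, no named facts). The four ingredients of
the Galerkin-level enstrophy Grönwall bound `‖∇w_N(t₂)‖² ≤ e^{C∫‖∇b‖_∞} ‖∇w_N(t₁)‖²` for the linear problem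
`∂ₜw + (b·∇)w + ∇π = ∇·(𝔸∇w)`, `∇·w = 0` with a constant tensor in a Legendre–Hadamard window and a smooth
divergence-free drift (cell `ad-ideate`, K1L_D, tenure ruling D26-17 (S2′); Robinson–Rodrigo–Sadowski 2016,
Thm. 4.4 Step 2 and §6.1 (the enstrophy estimate); Constantin–Foias 1988, Ch. 8–9):

* `hasDerivWithinAt_weighted_sum_norm_sq` — `d/dt Σ_k w_k ‖α_k‖² = Σ_k w_k · 2Re⟪α_k, α'_k⟫` along a
  differentiable coefficient curve;
* `gradNormSq_realTrigPoly` — `‖∇ realTrigPoly S c‖² = 4π² Σ_{k∈S} |k|² ‖c k‖²`;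
* `sum_freqNormSq_mul_re_inner_eq` — **the weighted Parseval identity**
  `Σ_{k∈S} 4π²|k|² Re⟪c k, 𝓕F(k)⟫ = Σ_j ∫⟪∂_j (realTrigPoly S c), ∂_j F⟫` for smooth `F` (so the drift term of
  the enstrophy balance is `∫⟨−Δu, (b·∇)u⟩ = Σ_j ∫⟨∂_j u, ∂_j((b·∇)u)⟩`);
* `abs_sum_integral_inner_partialDeriv_convect_le` — **the transport enstrophy bound**
  `|Σ_j ∫⟪∂_j u, ∂_j((b·∇)u)⟫| ≤ (card d) · G · ‖∇u‖²` for smooth `u`, smooth divergence-free `b` with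
  `|∂_c b_a| ≤ G` pointwise (`∂_j((b·∇)u) = (b·∇)∂_j u + (∂_j b·∇)u` and `∫⟪v,(b·∇)v⟫ = 0`);
* `sum_freqNormSq_mul_re_inner_leraySym_symbT_nonneg` — **the tensor viscous term has a sign**:
  `0 ≤ lo Σ |k|⁴‖c_k‖² ≤ Σ_{k∈S} |k|² Re⟪c k, Π_k T_𝔸(k) c k⟫` on transversal families (`NearIso 𝔸 lo hi`,
  `lo ≥ 0`; no condition on the odd part of `𝔸`: the weight `|k|²` is scalar).

## References

* J. C. Robinson, J. L. Rodrigo, W. Sadowski, *The three-dimensional Navier–Stokes equations* (CUP 2016), Thm. 4.4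
  Step 2, §6.1. [`RobinsonRodrigoSadowski2016`]
* P. Constantin, C. Foias, *Navier–Stokes Equations* (Chicago 1988), Ch. 8 (8.3)–(8.9), Ch. 9. [`ConstantinFoias1988`]
* U. Frisch, *Turbulence* (CUP 1995), §9.6.3 eq. (9.57). [`Frisch1995Turbulence`]
-/

open MeasureTheory Set Filter Topology UnitAddTorus
open scoped ENNReal NNReal InnerProductSpace

noncomputable section

namespace Literature.Analysis.FluidPDE

namespace Torus

open FunctionSpaces.Torus FunctionSpaces

variable {d : Type*} [Fintype d] [DecidableEq d] {S : Finset (d → ℤ)}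

/-! ## Weighted coefficient energies along curves -/

omit [DecidableEq d] in
/-- Derivative of a weighted coefficient energy `Σ_k w_k ‖β k‖²` along a differentiable curve in `S → ℂ^d`:
`d/dt Σ_k w_k‖β k‖² = Σ_k w_k · 2 Re⟪β k, β' k⟫`. [cite: RobinsonRodrigoSadowski2016, Thm. 4.4 Step 2 (4.6)] -/
theorem hasDerivWithinAt_weighted_sum_norm_sq (w : ↥S → ℝ) {β : ℝ → ↥S → EuclideanSpace ℂ d}
    {v : ↥S → EuclideanSpace ℂ d} {s : Set ℝ} {t : ℝ} (h : HasDerivWithinAt β v s t) :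
    HasDerivWithinAt (fun τ => ∑ k, w k * ‖β τ k‖ ^ 2) (∑ k, w k * (2 * (inner ℂ (β t k) (v k)).re)) s t := by
  have hk : ∀ k : ↥S, HasDerivWithinAt (fun τ => β τ k) (v k) s t := fun k =>
    (ContinuousLinearMap.proj (R := ℝ) (φ := fun _ : ↥S => EuclideanSpace ℂ d) k).hasFDerivAt
      |>.comp_hasDerivWithinAt t h
  have := HasDerivWithinAt.fun_sum (u := Finset.univ) fun k _ => ((hk k).norm_sq).const_mul (w k)
  simp only [real_inner_eq_re_inner_euclidean] at this
  convert this using 1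

/-- **The enstrophy of a real trigonometric polynomial** on a symmetric `S`:
`‖∇ realTrigPoly S c‖² = 4π² Σ_{k∈S} |k|² ‖c k‖²`. [cite: RobinsonRodrigoSadowski2016, Thm. 4.4 Step 2 (4.8)] -/
theorem gradNormSq_realTrigPoly (hS : ∀ k ∈ S, -k ∈ S) {c : (d → ℤ) → EuclideanSpace ℂ d} (hc : IsConjSymm c) :
    FunctionSpaces.Torus.gradNormSq (realTrigPoly S c) = 4 * Real.pi ^ 2 * ∑ k ∈ S, freqNormSq k * ‖c k‖ ^ 2 := by
  rw [← toReal_eGradNormSq_realTrigPoly hS hc, eGradNormSq_eq_ofReal_gradNormSq (isSmooth_realTrigPoly S c),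
    ENNReal.toReal_ofReal]
  unfold FunctionSpaces.Torus.gradNormSq
  positivity

/-! ## The weighted Parseval identity -/

/-- **Weighted Parseval**: for a conjugate-symmetric family `c` on a symmetric `S` and a smooth field `F`,
`Σ_{k∈S} 4π²|k|² Re⟪c k, 𝓕(F)(k)⟫ = Σ_j ∫⟪∂_j (realTrigPoly S c), ∂_j F⟫` (`∂_j realTrigPoly S c` is the
trigonometric polynomial with coefficients `2πi k_j c k`; `𝓕(∂_j F)(k) = 2πi k_j 𝓕F(k)`).
[cite: RobinsonRodrigoSadowski2016, Thm. 4.4 Step 2 (4.6)–(4.8)] -/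
theorem sum_freqNormSq_mul_re_inner_eq (hS : ∀ k ∈ S, -k ∈ S) {c : (d → ℤ) → EuclideanSpace ℂ d}
    (hc : IsConjSymm c) {F : UnitAddTorus d → EuclideanSpace ℝ d} (hF : IsSmooth F) :
    ∑ k ∈ S, 4 * Real.pi ^ 2 * freqNormSq k * (inner ℂ (c k) (mFourierCoeff (EuclideanSpace.complexify ∘ F) k)).re =
      ∑ j, ∫ x, ⟪FunctionSpaces.Torus.partialDeriv j (realTrigPoly S c) x, FunctionSpaces.Torus.partialDeriv j F x⟫_ℝ := by
  have hj : ∀ j, ∫ x, ⟪FunctionSpaces.Torus.partialDeriv j (realTrigPoly S c) x, FunctionSpaces.Torus.partialDeriv j F x⟫_ℝ =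
      ∑ k ∈ S, 4 * Real.pi ^ 2 * (k j : ℝ) ^ 2 * (inner ℂ (c k) (mFourierCoeff (EuclideanSpace.complexify ∘ F) k)).re := by
    intro j
    rw [partialDeriv_realTrigPoly' S c j, integral_inner_realTrigPoly_left hS (hc.deriv j) ((hF.partialDeriv j).memLp 2)]
    refine Finset.sum_congr rfl fun k _ => ?_
    have hco : mFourierCoeff (EuclideanSpace.complexify ∘ FunctionSpaces.Torus.partialDeriv j F) k =
        (2 * Real.pi * Complex.I * (k j)) • mFourierCoeff (EuclideanSpace.complexify ∘ F) k := by
      have e : (EuclideanSpace.complexify ∘ FunctionSpaces.Torus.partialDeriv j F) = FunctionSpaces.Torus.partialDeriv j (EuclideanSpace.complexify ∘ F) := by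
        funext x; exact (partialDeriv_complexify_comp hF j x).symm
      rw [e, mFourierCoeff_partialDeriv (hF.complexify_comp) j k]
    rw [hco, inner_smul_left, inner_smul_right]
    have h2 : (starRingEnd ℂ) (2 * Real.pi * Complex.I * (k j)) * (2 * Real.pi * Complex.I * (k j)) =
        ((4 * Real.pi ^ 2 * (k j : ℝ) ^ 2 : ℝ) : ℂ) := by
      simp only [map_mul, Complex.conj_ofReal, Complex.conj_I, map_ofNat, map_intCast]
      push_cast
      ring_nf
      rw [Complex.I_sq]
      ring
    rw [← mul_assoc, h2, Complex.re_ofReal_mul]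
  simp_rw [hj]
  rw [Finset.sum_comm]
  refine Finset.sum_congr rfl fun k _ => ?_
  rw [← Finset.sum_mul, freqNormSq]
  congr 1
  rw [Finset.mul_sum]

/-! ## The transport enstrophy bound -/

/-- **Transport enstrophy bound.** For smooth `u`, a smooth divergence-free `b` with `|∂_c b_a(x)| ≤ G` for all
`x, c, a`: `|Σ_j ∫⟪∂_j u, ∂_j((b·∇)u)⟫| ≤ (card d)·G·‖∇u‖²`
(`∂_j((b·∇)u) = (b·∇)∂_j u + (∂_j b·∇)u`, `∫⟪∂_j u,(b·∇)∂_j u⟫ = 0`, Cauchy–Schwarz).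
[cite: RobinsonRodrigoSadowski2016, §6.1] [cite: ConstantinFoias1988, Ch. 9] -/
theorem abs_sum_integral_inner_partialDeriv_convect_le {b u : UnitAddTorus d → EuclideanSpace ℝ d}
    (hb : IsSmooth b) (hbdiv : IsDivFree b) (hu : IsSmooth u) {G : ℝ} (hG0 : 0 ≤ G)
    (hG : ∀ x c a, |FunctionSpaces.Torus.partialDeriv c b x a| ≤ G) :
    |∑ j, ∫ x, ⟪FunctionSpaces.Torus.partialDeriv j u x, FunctionSpaces.Torus.partialDeriv j (FunctionSpaces.Torus.convect b u) x⟫_ℝ| ≤ (Fintype.card d : ℝ) * G * FunctionSpaces.Torus.gradNormSq u := by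
  -- split `∂_j((b·∇)u)` and kill the `(b·∇)∂_j u` part
  have hsplit : ∀ j, ∫ x, ⟪FunctionSpaces.Torus.partialDeriv j u x, FunctionSpaces.Torus.partialDeriv j (FunctionSpaces.Torus.convect b u) x⟫_ℝ =
      ∫ x, ⟪FunctionSpaces.Torus.partialDeriv j u x, FunctionSpaces.Torus.convect (FunctionSpaces.Torus.partialDeriv j b) u x⟫_ℝ := by
    intro j
    have e : ∀ x, ⟪FunctionSpaces.Torus.partialDeriv j u x, FunctionSpaces.Torus.partialDeriv j (FunctionSpaces.Torus.convect b u) x⟫_ℝ =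
        ⟪FunctionSpaces.Torus.partialDeriv j u x, FunctionSpaces.Torus.convect b (FunctionSpaces.Torus.partialDeriv j u) x⟫_ℝ + ⟪FunctionSpaces.Torus.partialDeriv j u x, FunctionSpaces.Torus.convect (FunctionSpaces.Torus.partialDeriv j b) u x⟫_ℝ := by
      intro x
      rw [partialDeriv_convect_eq_add_convect hb hu j x, inner_add_right]
    simp_rw [e]
    have i1 : Integrable (fun x => ⟪FunctionSpaces.Torus.partialDeriv j u x, FunctionSpaces.Torus.convect b (FunctionSpaces.Torus.partialDeriv j u) x⟫_ℝ) volume :=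
      (((hu.partialDeriv j).continuous.inner (hb.convect (hu.partialDeriv j)).continuous).integrable_of_hasCompactSupport
        (HasCompactSupport.of_compactSpace _))
    have i2 : Integrable (fun x => ⟪FunctionSpaces.Torus.partialDeriv j u x, FunctionSpaces.Torus.convect (FunctionSpaces.Torus.partialDeriv j b) u x⟫_ℝ) volume :=
      (((hu.partialDeriv j).continuous.inner ((hb.partialDeriv j).convect hu).continuous).integrable_of_hasCompactSupport
        (HasCompactSupport.of_compactSpace _))
    rw [integral_add i1 i2, integral_inner_convect_right_self_eq_zero hb hbdiv (hu.partialDeriv j), zero_add]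
  simp_rw [hsplit]
  -- pointwise Cauchy–Schwarz
  have hpt : ∀ x, |∑ j, ⟪FunctionSpaces.Torus.partialDeriv j u x, FunctionSpaces.Torus.convect (FunctionSpaces.Torus.partialDeriv j b) u x⟫_ℝ| ≤
      (Fintype.card d : ℝ) * G * ∑ j, ‖FunctionSpaces.Torus.partialDeriv j u x‖ ^ 2 := by
    intro x
    have h1 : ∀ j, |⟪FunctionSpaces.Torus.partialDeriv j u x, FunctionSpaces.Torus.convect (FunctionSpaces.Torus.partialDeriv j b) u x⟫_ℝ| ≤
        ‖FunctionSpaces.Torus.partialDeriv j u x‖ * (G * ∑ a, ‖FunctionSpaces.Torus.partialDeriv a u x‖) := by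
      intro j
      refine (abs_real_inner_le_norm _ _).trans (mul_le_mul_of_nonneg_left ?_ (norm_nonneg _))
      rw [convect_eq_sum_smul_partialDeriv (hu.isContDiff (by simp)) x, Finset.mul_sum]
      refine (norm_sum_le _ _).trans (Finset.sum_le_sum fun a _ => ?_)
      rw [norm_smul, Real.norm_eq_abs]
      exact mul_le_mul_of_nonneg_right (hG x j a) (norm_nonneg _)
    calc |∑ j, ⟪FunctionSpaces.Torus.partialDeriv j u x, FunctionSpaces.Torus.convect (FunctionSpaces.Torus.partialDeriv j b) u x⟫_ℝ|
        ≤ ∑ j, |⟪FunctionSpaces.Torus.partialDeriv j u x, FunctionSpaces.Torus.convect (FunctionSpaces.Torus.partialDeriv j b) u x⟫_ℝ| := Finset.abs_sum_le_sum_abs _ _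
      _ ≤ ∑ j, ‖FunctionSpaces.Torus.partialDeriv j u x‖ * (G * ∑ a, ‖FunctionSpaces.Torus.partialDeriv a u x‖) := Finset.sum_le_sum fun j _ => h1 j
      _ = G * (∑ j, ‖FunctionSpaces.Torus.partialDeriv j u x‖) ^ 2 := by rw [← Finset.sum_mul, sq]; ring
      _ ≤ G * ((Fintype.card d : ℝ) * ∑ j, ‖FunctionSpaces.Torus.partialDeriv j u x‖ ^ 2) := by
          refine mul_le_mul_of_nonneg_left ?_ hG0
          have h := sq_sum_le_card_mul_sum_sq (s := Finset.univ) (f := fun j => ‖FunctionSpaces.Torus.partialDeriv j u x‖)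
          simpa using h
      _ = (Fintype.card d : ℝ) * G * ∑ j, ‖FunctionSpaces.Torus.partialDeriv j u x‖ ^ 2 := by ring
  have hint : ∀ j, Integrable (fun x => ⟪FunctionSpaces.Torus.partialDeriv j u x, FunctionSpaces.Torus.convect (FunctionSpaces.Torus.partialDeriv j b) u x⟫_ℝ) volume := fun j =>
    (((hu.partialDeriv j).continuous.inner ((hb.partialDeriv j).convect hu).continuous).integrable_of_hasCompactSupport
      (HasCompactSupport.of_compactSpace _))
  rw [← integral_finsetSum _ fun j _ => hint j]
  unfold FunctionSpaces.Torus.gradNormSq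
  rw [← integral_const_mul]
  refine (abs_integral_le_integral_abs).trans (integral_mono_of_nonneg (ae_of_all _ fun x => abs_nonneg _)
    ((Integrable.const_mul (integrable_finsetSum _ fun j _ =>
      ((hu.partialDeriv j).continuous.norm.pow 2).integrable_of_hasCompactSupport (HasCompactSupport.of_compactSpace _)) _))
    (ae_of_all _ hpt))

/-! ## The tensor viscous term has a sign -/

omit [DecidableEq d] in
/-- **Sign of the weighted tensor viscous term**: for `NearIso 𝔸 lo hi`, `0 ≤ lo` and a family `c` transversal
on `S`, `0 ≤ lo Σ_{k∈S} |k|⁴ ‖c k‖² ≤ Σ_{k∈S} |k|² Re⟪c k, Π_k T_𝔸(k) (c k)⟫` (the Leray projector is invisible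
against the transversal `c k`; `lo|k|²|z|² ≤ Re⟨z,T_𝔸(k)z⟩` on `k^⊥`; the anti-Hermitian part of `T_𝔸(k)` drops
because the weight is scalar). [cite: Frisch1995Turbulence, §9.6.3 eq. (9.57)] -/
theorem sum_freqNormSq_mul_re_inner_leraySym_symbT_nonneg {𝔸 : Visc4 d} {lo hi : ℝ} (h𝔸 : NearIso 𝔸 lo hi)
    (hlo : 0 ≤ lo) {c : (d → ℤ) → EuclideanSpace ℂ d} (hcT : IsTransversal S c) :
    lo * ∑ k ∈ S, freqNormSq k ^ 2 * ‖c k‖ ^ 2 ≤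
      ∑ k ∈ S, freqNormSq k * (inner ℂ (c k) (leraySym k (symbT 𝔸 k (c k)))).re ∧
    0 ≤ ∑ k ∈ S, freqNormSq k * (inner ℂ (c k) (leraySym k (symbT 𝔸 k (c k)))).re := by
  have h1 : lo * ∑ k ∈ S, freqNormSq k ^ 2 * ‖c k‖ ^ 2 ≤
      ∑ k ∈ S, freqNormSq k * (inner ℂ (c k) (leraySym k (symbT 𝔸 k (c k)))).re := by
    rw [Finset.mul_sum]
    refine Finset.sum_le_sum fun k hk => ?_
    rw [inner_leraySym_right_of_transversal _ _ (hcT k hk)]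
    have h := lo_mul_le_re_inner_symbT h𝔸 (hcT k hk)
    have hf : 0 ≤ freqNormSq k := freqNormSq_nonneg k
    calc lo * (freqNormSq k ^ 2 * ‖c k‖ ^ 2) = freqNormSq k * (lo * (freqNormSq k * ‖c k‖ ^ 2)) := by ring
      _ ≤ freqNormSq k * (inner ℂ (c k) (symbT 𝔸 k (c k))).re := mul_le_mul_of_nonneg_left h hf
  refine ⟨h1, le_trans ?_ h1⟩
  exact mul_nonneg hlo (Finset.sum_nonneg fun k _ => by positivity)

end Torus

end Literature.Analysis.FluidPDE
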